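import Literature.NumberTheory.Automorphic.IdeleNormOneSplitting
import Literature.NumberTheory.Automorphic.IdeleClassIntegration
import Literature.NumberTheory.Automorphic.GLnQuotientSubgroupHaar
import Literature.NumberTheory.Automorphic.GLnCentralCharacter
import Literature.NumberTheory.Automorphic.MirabolicAveraging
import Literature.NumberTheory.Automorphic.GLnAdelicIntegrationFactsProofs
import Literature.NumberTheory.Automorphic.SiegelSetVolume
import Literature.MeasureTheory.Group.CoveringWeights
import HarnessLib

/-!
# Unfolding the automorphic quotient against an idele-class Eisenstein integral:
`∫_X E_W(g_x⁻¹) F(x) dμ = C ∫_{GL_n(𝔸_K)} W(g) β_{GL_n(K)}(g) F(π g⁻¹) dν(g)`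
(Jacquet–Shalika (1981), §4, (4.2)–(4.4); Cogdell (2004), §2.3, the first unfolding of
`I(s; φ, φ', Φ) = ∫_{Z GL_n(k)\GL_n(𝔸)} φ φ' E(g, Φ; s)`)

Topic `NumberTheory/Automorphic`; namespace `Literature.NumberTheory.Automorphic`. Proof file (theorems
only). A brick of the inline decomposition of the named facts
`JacquetShalika1981_partialPairL_pole_of_eq_conj` / `…_boundary_of_ne_one` (Arthur–Clozel (1989), Ch. 3,
(2.2)–(2.3)): the bridge between the tree's Rankin–Selberg integral on the honest automorphic quotient
`X = GL_n(𝔸_K) ⧸ A_G GL_n(K)` (`rankinSelbergIntegral`, against the mirabolic Eisenstein series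
`E(g, Φ; s) = |det g|^s Σ_{ξ ∈ ℙ^{n-1}(K)} ∫_{𝔸_Kˣ} Φ(a ξ g) |a|^{ns} d^×a`, `MirabolicEisensteinSeries`) and
the covering-weight integrals `∫_{GL_n(𝔸_K)} ‖φ‖² E_w β_{GL_n(K)} dν` over the group in which the
Fourier–Whittaker unfolding of the tree is written (`WhittakerTowerParseval`,
`exists_mul_rankinSelbergTorusIntegral_eq_lintegral_eisensteinWeight`).

Everything is in `[0, ∞]` and for a **general weight**: let `W ≥ 0` be a measurable function on
`GL_n(𝔸_K)`, left invariant under `GL_n(K)` (in the application `W = E_w = Σ_{v ∈ Kⁿ∖0} w(v g)`, the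
incomplete theta sum of `w(g) = Φ(e_n g) |det g|^σ`, possibly multiplied by a function of `|det g|`),
`𝓕 ⊆ 𝔸_Kˣ` an idele class domain, and

  `E_W(y) = ∫_𝓕 W(a · y) dν_I(a)`  (`a · y = (a 1_n) y`, `ν_I` a Haar measure of `𝔸_Kˣ`)

its idele-class Eisenstein integral — for `W = E_{w_s}` this is the Eisenstein series `E(y, Φ; s)`
(`mirabolicEisenstein_one_eq_setIntegral_thetaStar`: the sum over `ℙ^{n-1}(K)` and the integral over
`𝔸_Kˣ` recombine into the sum over `Kⁿ ∖ 0` and the integral over `𝔸_Kˣ / Kˣ`). Then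
(`exists_lintegral_eisensteinLIntegral_mul_eq`, **main**): there is `C ∈ (0, ∞)` depending only on the
measures such that for every measurable `F ≥ 0` on `X` invariant under the centre `Z(𝔸_K)` and every
measurable `GL_n(K)`-covering weight `β`,

  `∫_X E_W(g_x⁻¹) F(x) dμ(x) = C ∫_{GL_n(𝔸_K)} W(g) β(g) F(π g⁻¹) dν(g)`.

Proof: Weil's formula for the closed subgroup `H = A_G GL_n(K)` (`lintegral_fiberLIntegral_mul_eq_automorphic`,
`GLnAutomorphicUnfolding`) with `ρ_H = κ (da ⊗ counting)` (`GLnQuotientSubgroupHaar`), applied to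
`f(y) = (∫_{𝕀_K¹} W(b · y⁻¹) β¹(b) dβ) β(y⁻¹)` with `β¹` a `Kˣ`-covering weight on the norm-one ideles:
the sum over `GL_n(K)` collapses the covering weight `β`, the integral over `A_G ≅ ρ(ℝ_{>0})` and the
integral over `𝕀_K¹` recombine into the integral over `𝔸_Kˣ` by the splitting `𝕀_K = 𝕀_K¹ × ρ(ℝ_{>0})`
(`IdeleNormOneSplitting`), and the sum over `Kˣ` folds `𝔸_Kˣ` onto `𝓕` collapsing `β¹`
(`IdeleClassIntegration`), which identifies the fibre integral of `f` with `E_W(g⁻¹)` up to a constant;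
on the group side the `𝕀_K¹`-average disappears by the central invariance of `F` and the independence of
the covering weight (`CoveringWeights`). Also:

* `exists_continuousMulEquiv_posRealIdeles_center'` — `ρ(ℝ_{>0}) ≃ₜ* A_G`, `p ↦ p · 1_n` (`0 < n`);
* `exists_isCoveringWeight_normOne` — a `Kˣ`-covering weight `β¹` on `𝕀_K¹` with
  `0 < ∫ β¹ dβ < ∞` (`𝕀_K¹ / Kˣ` is compact: `exists_isCompact_normOne_cover`), for the copy
  `(principalIdeles K).subgroupOf (normOneIdeles K)` of `Kˣ` inside `𝕀_K¹`;
* `setLIntegral_ideleClassDomain_scalar_mul_eq_of_mem` — `E_W(h y) = E_W(y)` for `h ∈ A_G GL_n(K)`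
  (so that `E_W(g⁻¹)` is a function on `X`).

## References

* H. Jacquet, J. A. Shalika, *On Euler products and the classification of automorphic
  representations I*, Amer. J. Math. 103 (1981), §4 [JacquetShalikaAJM1981].
* J. W. Cogdell, *Analytic theory of L-functions for GL_n*, in *An Introduction to the Langlands
  Program* (2004), §2.3 (PDF pp. 186–188 of the held copy) [CogdellAnalyticTheory2004].
* J. R. Getz, H. Hahn, *An Introduction to Automorphic Representations* (2024), Thm. 3.2.2, Lemma 9.2.4
  [GetzHahn2024].
* A. Weil, *Basic Number Theory* (1967), Ch. IV §4 [WeilBNT1967].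
-/

noncomputable section

open MeasureTheory Measure Set Filter Topology IsDedekindDomain NumberField
open Literature.MeasureTheory.Group
open scoped ENNReal NNReal Pointwise

namespace Literature.NumberTheory.Automorphic

open Literature.NumberTheory.GaloisRepresentations (ideleGroup principalIdeles)

-- the quotient carries the tree's Borel σ-algebra, not Mathlib's quotient σ-algebra
attribute [-instance] Quotient.instMeasurableSpace QuotientGroup.measurableSpace

/-! ### `ρ(ℝ_{>0}) ≃ₜ* A_G` -/

section Center

variable (n : ℕ) (K : Type) [Field K] [NumberField K]

/-- **The split component of `GL₁` is the centre `A_G` of the automorphic quotient of `GL_n`**: for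
`0 < n` there is an isomorphism of topological groups `ρ(ℝ_{>0}) ≃ₜ* A_G`, `p ↦ p · 1_n` (inverse
`a ↦ ρ(|det a|_𝔸^{1/(n[K:ℚ])})`, continuous by `continuous_ideleNormUnits`, `continuous_posRealIdele`).
[cite: WeilBNT1967, Ch. IV §4 Cor. 2 of Thm. 5] -/
theorem exists_continuousMulEquiv_posRealIdeles_center' (hn : 0 < n) :
    ∃ e : ↥(posRealIdeles K) ≃ₜ* ↥(AdelicGroupData.gl n K).center',
      ∀ p : ↥(posRealIdeles K), ((e p : ↥(AdelicGroupData.gl n K).center') : (AdelicGroupData.gl n K).Adelic) =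
        Matrix.GeneralLinearGroup.scalar (Fin n) (p : ideleGroup K) := by
  set N : ℕ := n * Module.finrank ℚ K with hN
  have hN0 : N ≠ 0 := Nat.mul_ne_zero hn.ne' Module.finrank_pos.ne'
  -- the `N`-th root on `ℝ_{>0}`
  let root : ℝ≥0ˣ →* ℝ≥0ˣ := Units.map (NNReal.rpowMonoidHom ((N : ℝ)⁻¹))
  have hroot : ∀ t : ℝ≥0ˣ, (root t : ℝ≥0) = (t : ℝ≥0) ^ ((N : ℝ)⁻¹) := fun t => rfl
  have hroot_pow' : ∀ t : ℝ≥0ˣ, root (t ^ N) = t := fun t =>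
    Units.ext (by rw [hroot, Units.val_pow_eq_pow_val, NNReal.pow_rpow_inv_natCast _ hN0])
  have hroot_cont : Continuous root :=
    Continuous.units_map _ (NNReal.continuous_rpow_const (by positivity))
  -- the inverse map `a ↦ root |det a|`
  let ψ : (AdelicGroupData.gl n K).Adelic → ℝ≥0ˣ := fun a =>
    root (ideleNormUnits K (Matrix.GeneralLinearGroup.det (a : GL (Fin n) (AdeleRing (𝓞 K) K))))
  have hψ_cont : Continuous ψ :=
    hroot_cont.comp ((continuous_ideleNormUnits K).comp Matrix.GeneralLinearGroup.continuous_det)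
  have hψ_scalar : ∀ s : ℝ≥0ˣ, ψ (posRealScalar n K s) = s := by
    intro s
    change root (ideleNormUnits K (Matrix.GeneralLinearGroup.det (posRealScalar n K s))) = s
    rw [ideleNormUnits_det_posRealScalar n K s, ← hN, hroot_pow']
  -- membership of scalars of `ρ(ℝ_{>0})` in `A_G`
  have hmem : ∀ p : ↥(posRealIdeles K),
      Matrix.GeneralLinearGroup.scalar (Fin n) (p : ideleGroup K) ∈ (AdelicGroupData.gl n K).center' := by
    intro p
    obtain ⟨s, hs⟩ := p.2
    exact ⟨s, by rw [← hs]; rfl⟩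
  refine ⟨{ toFun := fun p => ⟨Matrix.GeneralLinearGroup.scalar (Fin n) (p : ideleGroup K), hmem p⟩
            invFun := fun a => ⟨posRealIdele K (ψ (a : (AdelicGroupData.gl n K).Adelic)),
              posRealIdele_mem_posRealIdeles K _⟩
            left_inv := ?_
            right_inv := ?_
            map_mul' := ?_
            continuous_toFun := ?_
            continuous_invFun := ?_ }, fun p => rfl⟩
  · intro p
    obtain ⟨s, hs⟩ := p.2
    refine Subtype.ext ?_
    change posRealIdele K (ψ (Matrix.GeneralLinearGroup.scalar (Fin n) (p : ideleGroup K))) = (p : ideleGroup K)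
    rw [← hs]
    exact congrArg (posRealIdele K) (hψ_scalar s)
  · intro a
    obtain ⟨s, hs⟩ := a.2
    refine Subtype.ext ?_
    change Matrix.GeneralLinearGroup.scalar (Fin n) (posRealIdele K (ψ (a : (AdelicGroupData.gl n K).Adelic))) =
      (a : (AdelicGroupData.gl n K).Adelic)
    rw [← hs, hψ_scalar s]
    rfl
  · intro p q
    exact Subtype.ext (map_mul (Matrix.GeneralLinearGroup.scalar (Fin n)) (p : ideleGroup K) (q : ideleGroup K))
  · exact ((continuous_generalLinearGroup_scalar_adele n K).comp continuous_subtype_val).subtype_mk _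
  · exact ((continuous_posRealIdele K).comp (hψ_cont.comp continuous_subtype_val)).subtype_mk _

end Center

/-! ### A `Kˣ`-covering weight on the norm-one ideles -/

section NormOne

variable (K : Type) [Field K] [NumberField K]

/-- The copy `Kˣ ∩ 𝕀_K¹ = Kˣ` of the principal ideles inside `𝕀_K¹` (product formula) is discrete
(`Kˣ` is discrete in `𝕀_K`). [folklore] -/
theorem discreteTopology_principalIdeles_subgroupOf_normOne :
    DiscreteTopology ↥((principalIdeles K).subgroupOf (normOneIdeles K)) := by
  haveI := discreteTopology_principalIdeles K
  have hcont : Continuous fun k : ↥((principalIdeles K).subgroupOf (normOneIdeles K)) =>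
      (⟨((k : ↥(normOneIdeles K)) : ideleGroup K), Subgroup.mem_subgroupOf.1 k.2⟩ : ↥(principalIdeles K)) :=
    Continuous.subtype_mk (continuous_subtype_val.comp continuous_subtype_val) _
  refine DiscreteTopology.of_continuous_injective hcont ?_
  intro k k' h
  have h1 := congrArg Subtype.val h
  exact Subtype.ext (Subtype.ext h1)

variable [MeasurableSpace (ideleGroup K)] [BorelSpace (ideleGroup K)]

/-- **A `Kˣ`-covering weight on `𝕀_K¹` of positive finite total mass.** For every Haar measure `β` on
the norm-one ideles there is a measurable `β¹ : 𝕀_K¹ → [0, ∞]` with `Σ_{k ∈ Kˣ} β¹(k b) = 1` for all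
`b` and `0 < ∫ β¹ dβ < ∞` — a smooth fundamental domain for `Kˣ` in `𝕀_K¹` (`exists_isCoveringWeight`);
its mass is finite because `𝕀_K¹ = W Kˣ` for a compact `W` (`exists_isCompact_normOne_cover`,
Cassels–Fröhlich II §16) and positive because its `Kˣ`-translates sum to `1`. The mass `∫ β¹ dβ` is the
volume of `𝕀_K¹ / Kˣ`. [cite: CasselsFrohlichANT1967, Ch. II §16 Theorem] -/
theorem exists_isCoveringWeight_normOne (β : Measure ↥(normOneIdeles K)) [β.IsHaarMeasure] :
    ∃ β₁ : ↥(normOneIdeles K) → ℝ≥0∞, IsCoveringWeight ↥((principalIdeles K).subgroupOf (normOneIdeles K)) β₁ ∧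
      ∫⁻ b, β₁ b ∂β ≠ 0 ∧ ∫⁻ b, β₁ b ∂β ≠ ⊤ := by
  haveI := secondCountableTopology_ideleGroup K
  haveI := t2Space_ideleGroup K
  haveI := locallyCompactSpace_ideleGroup K
  haveI : SecondCountableTopology ↥(normOneIdeles K) := TopologicalSpace.Subtype.secondCountableTopology _
  haveI : BorelSpace ↥(normOneIdeles K) := Subtype.borelSpace _
  haveI := discreteTopology_principalIdeles_subgroupOf_normOne K
  haveI : Countable ↥((principalIdeles K).subgroupOf (normOneIdeles K)) :=
    Countable.of_equiv _ (Subgroup.subgroupOfEquivOfLe (principalIdeles_le_normOneIdeles K)).symm.toEquiv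
  set Γ₁ : Subgroup ↥(normOneIdeles K) := (principalIdeles K).subgroupOf (normOneIdeles K) with hΓ₁
  obtain ⟨β₁, hβ₁⟩ := exists_isCoveringWeight Γ₁
  refine ⟨β₁, hβ₁, ?_, ?_⟩
  · -- positivity: if `∫ β¹ = 0` then `β¹ = 0` a.e., hence `Σ_k β¹(k b) = 0` a.e., contradicting `= 1`
    intro h0
    have hae : β₁ =ᵐ[β] 0 := (lintegral_eq_zero_iff hβ₁.measurable).1 h0
    have hae' : ∀ k : ↥Γ₁, (fun b => β₁ (k • b)) =ᵐ[β] 0 := fun k =>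
      (measurePreserving_smul k β).quasiMeasurePreserving.ae_eq hae
    have hall : ∀ᵐ b ∂β, ∀ k : ↥Γ₁, β₁ (k • b) = 0 := ae_all_iff.2 hae'
    have hfalse : ∀ᵐ b ∂β, False := by
      filter_upwards [hall] with b hb
      have h1 := hβ₁.coveringSum_eq b
      rw [coveringSum_apply] at h1
      simp only [hb, tsum_zero] at h1
      exact zero_ne_one h1
    rw [ae_iff] at hfalse
    simp only [not_false_eq_true, Set.setOf_true] at hfalse
    exact (isOpen_univ.measure_pos β univ_nonempty).ne' hfalse
  · -- finiteness: domination by the compact cover `W` of `𝕀_K¹ / Kˣ`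
    obtain ⟨W, hWc, -, hcov, -⟩ := exists_isCompact_normOne_cover K
    set S : Set ↥(normOneIdeles K) := Subtype.val ⁻¹' W with hS
    have hSc : IsCompact S := (isClosed_normOneIdeles K).isClosedEmbedding_subtypeVal.isCompact_preimage hWc
    have hSm : MeasurableSet S := hSc.measurableSet
    have hone : ∀ b : ↥(normOneIdeles K), (1 : ℝ≥0∞) ≤ coveringSum ↥Γ₁ (S.indicator 1) b := by
      intro b
      obtain ⟨k, w, hw, hbw⟩ := hcov (b : ideleGroup K) (mem_normOneIdeles.1 b.2)
      -- `k⁻¹ • b = w ∈ W`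
      have hkn : principalIdele K k ∈ normOneIdeles K := principalIdeles_le_normOneIdeles K ⟨k, rfl⟩
      set γ : ↥Γ₁ := ⟨⟨principalIdele K k, hkn⟩, show (⟨principalIdele K k, hkn⟩ : ↥(normOneIdeles K)).1 ∈
        principalIdeles K from ⟨k, rfl⟩⟩⁻¹ with hγ
      have hγb : γ • b ∈ S := by
        change ((((γ : ↥Γ₁) : ↥(normOneIdeles K)) * b : ↥(normOneIdeles K)) : ideleGroup K) ∈ W
        rw [Subgroup.coe_mul, hγ, Subgroup.coe_inv]
        change (principalIdele K k)⁻¹ * (b : ideleGroup K) ∈ W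
        rw [hbw, mul_comm w, inv_mul_cancel_left]
        exact hw
      calc (1 : ℝ≥0∞) = S.indicator 1 (γ • b) := by rw [Set.indicator_of_mem hγb, Pi.one_apply]
        _ ≤ coveringSum ↥Γ₁ (S.indicator 1) b := by
            rw [coveringSum_apply]; exact ENNReal.le_tsum γ
    have hdom := lintegral_mul_le_inv_mul_setLIntegral_of_le_coveringSum_indicator β
      (F := fun _ => (1 : ℝ≥0∞)) measurable_const (fun _ _ => rfl) hβ₁.measurable
      (fun b => (hβ₁.coveringSum_eq b).le) hSm one_ne_zero ENNReal.one_ne_top hone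
    simp only [one_mul, inv_one, lintegral_one, Measure.restrict_apply_univ] at hdom
    exact ne_top_of_le_ne_top (hSc.measure_lt_top).ne hdom

end NormOne

/-! ### The idele-class Eisenstein integral `E_W(y) = ∫_𝓕 W(a · y) dν_I(a)` is `A_G GL_n(K)`-invariant -/

section Invariance

variable {n : ℕ} {K : Type} [Field K] [NumberField K]

/-- Scalars of principal ideles are rational points: `(k) · 1_n = (k · 1_n)_𝔸` for `k ∈ Kˣ` (Mathlib
`Matrix.GeneralLinearGroup.map_scalar`). [folklore] -/
theorem exists_map_eq_scalar_of_mem_principalIdeles {k : ideleGroup K} (hk : k ∈ principalIdeles K) :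
    ∃ γ : GL (Fin n) K, Matrix.GeneralLinearGroup.map (algebraMap K (AdeleRing (𝓞 K) K)) γ =
      Matrix.GeneralLinearGroup.scalar (Fin n) k := by
  obtain ⟨q, rfl⟩ := hk
  exact ⟨Matrix.GeneralLinearGroup.scalar (Fin n) q, Matrix.GeneralLinearGroup.map_scalar _ _⟩

variable [MeasurableSpace (ideleGroup K)] [BorelSpace (ideleGroup K)]

/-- **`E_W(h y) = E_W(y)` for `h ∈ A_G GL_n(K)`.** Let `W ≥ 0` on `GL_n(𝔸_K)` be left `GL_n(K)`-invariant,
`𝓕 ⊆ 𝔸_Kˣ` an idele class domain and `ν_I` a Haar measure on `𝔸_Kˣ`. Then the idele-class Eisenstein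
integral `y ↦ ∫_𝓕 W((a 1_n) y) dν_I(a)` is left invariant under `A_G GL_n(K)`: under `GL_n(K)` because the
scalars are central and `W` is invariant; under `a₀ 1_n ∈ A_G` because the substitution `a ↦ a a₀` moves `𝓕`
to the idele class domain `a₀ 𝓕` over which the `Kˣ`-invariant integrand has the same integral
(`IsFundamentalDomain.setLIntegral_eq`). Hence `E_W(g⁻¹)` is a function on the automorphic quotient
`GL_n(𝔸_K) ⧸ A_G GL_n(K)` (Cogdell (2004), §2.3: `E(g, Φ; s)` is an automorphic form on
`Z(𝔸) GL_n(k) \ GL_n(𝔸)`). [cite: CogdellAnalyticTheory2004, §2.3] -/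
theorem setLIntegral_ideleClassDomain_scalar_mul_eq_of_mem
    (νI : Measure (ideleGroup K)) [νI.IsHaarMeasure]
    {𝓕 : Set (ideleGroup K)} (h𝓕 : IsIdeleClassDomain K 𝓕)
    {W : GL (Fin n) (AdeleRing (𝓞 K) K) → ℝ≥0∞}
    (hWK : ∀ (γ : GL (Fin n) K) (g : GL (Fin n) (AdeleRing (𝓞 K) K)),
      W (Matrix.GeneralLinearGroup.map (algebraMap K (AdeleRing (𝓞 K) K)) γ * g) = W g)
    {h : GL (Fin n) (AdeleRing (𝓞 K) K)} (hh : h ∈ (AdelicGroupData.gl n K).quotientSubgroup)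
    (y : GL (Fin n) (AdeleRing (𝓞 K) K)) :
    ∫⁻ a in 𝓕, W (Matrix.GeneralLinearGroup.scalar (Fin n) a * (h * y)) ∂νI =
      ∫⁻ a in 𝓕, W (Matrix.GeneralLinearGroup.scalar (Fin n) a * y) ∂νI := by
  haveI := secondCountableTopology_ideleGroup K
  haveI := t2Space_ideleGroup K
  haveI := locallyCompactSpace_ideleGroup K
  haveI : MeasurableMul (ideleGroup K) := inferInstance
  -- the integrand is `Kˣ`-invariant in `a`, for every `y`
  have hinvK : ∀ (y : GL (Fin n) (AdeleRing (𝓞 K) K)) (k : ↥(principalIdeles K)) (a : ideleGroup K),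
      W (Matrix.GeneralLinearGroup.scalar (Fin n) (k • a) * y) =
        W (Matrix.GeneralLinearGroup.scalar (Fin n) a * y) := by
    intro y k a
    obtain ⟨γ, hγ⟩ := exists_map_eq_scalar_of_mem_principalIdeles (n := n) k.2
    rw [Subgroup.smul_def, smul_eq_mul, map_mul, mul_assoc, ← hγ, hWK]
  revert y
  change h ∈ (AdelicGroupData.gl n K).center' ⊔ (AdelicGroupData.gl n K).arithmeticSubgroup at hh
  rw [Subgroup.sup_eq_closure] at hh
  refine Subgroup.closure_induction (p := fun h _ => ∀ y : GL (Fin n) (AdeleRing (𝓞 K) K),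
    ∫⁻ a in 𝓕, W (Matrix.GeneralLinearGroup.scalar (Fin n) a * (h * y)) ∂νI =
      ∫⁻ a in 𝓕, W (Matrix.GeneralLinearGroup.scalar (Fin n) a * y) ∂νI) ?_ ?_ ?_ ?_ hh
  · rintro x (⟨t, rfl⟩ | ⟨γ, rfl⟩) y
    · -- central: `a ↦ a ρ(t)` moves `𝓕` to `ρ(t) 𝓕`
      set p : ideleGroup K := posRealIdele K t with hp
      set G : ideleGroup K → ℝ≥0∞ := fun a => W (Matrix.GeneralLinearGroup.scalar (Fin n) a * y) with hG
      have e1 : ∀ a, W (Matrix.GeneralLinearGroup.scalar (Fin n) a * (posRealScalar n K t * y)) = G (a * p) := by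
        intro a
        simp only [hG]
        change W (Matrix.GeneralLinearGroup.scalar (Fin n) a * (Matrix.GeneralLinearGroup.scalar (Fin n) p * y)) = _
        rw [map_mul, mul_assoc]
      have e2 : ∀ a, 𝓕.indicator (fun a => G (a * p)) a = (p • 𝓕).indicator G (a * p) := by
        intro a
        by_cases ha : a ∈ 𝓕
        · rw [Set.indicator_of_mem ha, Set.indicator_of_mem]
          rw [mul_comm]; exact Set.smul_mem_smul_set ha
        · rw [Set.indicator_of_notMem ha, Set.indicator_of_notMem]
          rw [mul_comm]; exact fun h' => ha (Set.smul_mem_smul_set_iff.1 h')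
      change ∫⁻ a in 𝓕, W (Matrix.GeneralLinearGroup.scalar (Fin n) a * (posRealScalar n K t * y)) ∂νI = ∫⁻ a in 𝓕, G a ∂νI
      simp_rw [e1]
      calc ∫⁻ a in 𝓕, G (a * p) ∂νI = ∫⁻ a, 𝓕.indicator (fun a => G (a * p)) a ∂νI :=
            (lintegral_indicator h𝓕.measurableSet _).symm
        _ = ∫⁻ a, (p • 𝓕).indicator G (a * p) ∂νI := lintegral_congr e2
        _ = ∫⁻ a, (p • 𝓕).indicator G a ∂νI := lintegral_mul_right_eq_self _ p
        _ = ∫⁻ a in p • 𝓕, G a ∂νI := lintegral_indicator (h𝓕.measurableSet.const_smul p) _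
        _ = ∫⁻ a in 𝓕, G a ∂νI :=
            ((h𝓕.smul p).isFundamentalDomain νI).setLIntegral_eq (h𝓕.isFundamentalDomain νI) G (hinvK y)
    · -- rational: the scalars are central and `W` is `GL_n(K)`-invariant
      refine lintegral_congr fun a => ?_
      change W (Matrix.GeneralLinearGroup.scalar (Fin n) a *
        (Matrix.GeneralLinearGroup.map (algebraMap K (AdeleRing (𝓞 K) K)) γ * y)) = _
      rw [← mul_assoc, Matrix.GeneralLinearGroup.scalar_commute a, mul_assoc, hWK]
  · intro y
    rw [one_mul]
  · intro x z _ _ hx hz y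
    rw [mul_assoc, hx, hz]
  · intro x _ hx y
    rw [← hx (x⁻¹ * y), mul_inv_cancel_left]

end Invariance

/-! ### The unfolding identity -/

section Unfolding

variable {n : ℕ} {K : Type} [Field K] [NumberField K]

-- Borel structures: `adelicBorel` on `(AdelicGroupData.gl n K).Adelic` (the spelling of the quotient files)
-- and `glAdeleBorel` on the definitionally equal `GL (Fin n) (AdeleRing (𝓞 K) K)` (the spelling of the
-- Whittaker tower); both are `borel _` (house idiom of `RankinSelbergTowerComparison`).
attribute [local instance] adelicBorel borelSpace_adelic locallyCompactSpace_adelic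
  secondCountableTopology_gl_adelic glAdeleBorel borelSpace_glAdele

variable [MeasurableSpace (ideleGroup K)] [BorelSpace (ideleGroup K)]

omit [MeasurableSpace (ideleGroup K)] [BorelSpace (ideleGroup K)] in
/-- `ratPoints ⊤ = GL_n(K)` (both are the range of the diagonal embedding). [folklore] -/
theorem ratPoints_top_eq_arithmeticSubgroup :
    ratPoints (n := n) (K := K) (⊤ : Subgroup (GL (Fin n) K)) = (AdelicGroupData.gl n K).arithmeticSubgroup := by
  rw [ratPoints, ← MonoidHom.range_eq_map]
  rfl

/-- **The fibre integral of the test function** (Step 1 of `exists_lintegral_eisensteinLIntegral_mul_eq`).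
For a central continuous homomorphism `sc : 𝔸_Kˣ → GL_n(𝔸_K)` sending principal ideles to rational points
(the scalar embedding), Haar measures `ν_I`, `β`, `α` on `𝔸_Kˣ`, `𝕀_K¹`, `ρ(ℝ_{>0})` related by the splitting
constant `κ₁` (`IdeleNormOneSplitting`), an isomorphism `ρ(ℝ_{>0}) ≃ A_G` compatible with `sc`, the fibre
constant `κ` of `ρ_H` (`GLnQuotientSubgroupHaar`), a `Kˣ`-covering weight `β¹` on `𝕀_K¹`, an idele class
domain `𝓕`, a `GL_n(K)`-invariant `W ≥ 0` and a `GL_n(K)`-covering weight `β`: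

  `∫_H f(g h) dρ_H(h) = κ κ₁⁻¹ ∫_𝓕 W(sc(a) g⁻¹) dν_I(a)`,  `f(y) = (∫_{𝕀¹} W(sc(b) y⁻¹) β¹(b) dβ) β(y⁻¹)`:

the sum over `GL_n(K)` collapses `β`, the integrals over `A_G` and `𝕀_K¹` recombine into `𝔸_Kˣ`, and the
sum over `Kˣ` folds `𝔸_Kˣ` onto `𝓕` collapsing `β¹`. [cite: JacquetShalikaAJM1981, §4] -/
theorem lintegral_quotientSubgroup_testFun_eq
    (νI : Measure (ideleGroup K)) [νI.IsHaarMeasure]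
    (β : Measure ↥(normOneIdeles K)) [SFinite β]
    (α : Measure ↥(posRealIdeles K)) [α.IsInvInvariant]
    (sc : ideleGroup K →* (AdelicGroupData.gl n K).Adelic) (hsc_cont : Continuous sc)
    (hsc_comm : ∀ (a : ideleGroup K) (g : (AdelicGroupData.gl n K).Adelic), sc a * g = g * sc a)
    (hscK : ∀ k : ideleGroup K, k ∈ principalIdeles K → ∃ γ : GL (Fin n) K, (AdelicGroupData.gl n K).toAdelic γ = sc k)
    (ec : ↥(posRealIdeles K) ≃ₜ* ↥(AdelicGroupData.gl n K).center')
    (hec : ∀ p : ↥(posRealIdeles K),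
      ((ec p : ↥(AdelicGroupData.gl n K).center') : (AdelicGroupData.gl n K).Adelic) = sc (p : ideleGroup K))
    {κ κ₁ : ℝ≥0} (hκ₁ : (κ₁ : ℝ≥0∞) ≠ 0)
    (hsplit : ∀ G : ideleGroup K → ℝ≥0∞, Measurable G →
      ∫⁻ x, G x ∂νI = κ₁ * ∫⁻ t, ∫⁻ b, G ((b : ideleGroup K) * (t : ideleGroup K)) ∂β ∂α)
    (hfib : ∀ Fh : ↥(AdelicGroupData.gl n K).quotientSubgroup → ℝ≥0∞, Measurable Fh →
      ∫⁻ h, Fh h ∂quotientSubgroupHaar n K = κ * ∫⁻ a, ∑' γ : ↥(AdelicGroupData.gl n K).arithmeticSubgroup,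
        Fh ((quotientSubgroupEquiv n K).symm (a, γ)) ∂(Measure.map ec α))
    {β₁ : ↥(normOneIdeles K) → ℝ≥0∞} (hβ₁ : IsCoveringWeight ↥((principalIdeles K).subgroupOf (normOneIdeles K)) β₁)
    {𝓕 : Set (ideleGroup K)} (h𝓕 : IsIdeleClassDomain K 𝓕)
    {W : (AdelicGroupData.gl n K).Adelic → ℝ≥0∞} (hW : Measurable W)
    (hWK : ∀ (γ : GL (Fin n) K) (y : (AdelicGroupData.gl n K).Adelic), W ((AdelicGroupData.gl n K).toAdelic γ * y) = W y)
    {βA : (AdelicGroupData.gl n K).Adelic → ℝ≥0∞} (hβA : Measurable βA)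
    (hβAsum : ∀ y, coveringSum ↥(AdelicGroupData.gl n K).arithmeticSubgroup βA y = 1)
    (g : (AdelicGroupData.gl n K).Adelic) :
    ∫⁻ h : ↥(AdelicGroupData.gl n K).quotientSubgroup,
        (∫⁻ b, W (sc (b : ideleGroup K) * (g * (h : (AdelicGroupData.gl n K).Adelic))⁻¹) * β₁ b ∂β) *
          βA (g * (h : (AdelicGroupData.gl n K).Adelic))⁻¹ ∂quotientSubgroupHaar n K =
      κ * (κ₁ : ℝ≥0∞)⁻¹ * ∫⁻ a in 𝓕, W (sc a * g⁻¹) ∂νI := by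
  classical
  haveI := secondCountableTopology_ideleGroup K
  haveI := t2Space_ideleGroup K
  haveI := locallyCompactSpace_ideleGroup K
  haveI : MeasurableMul (ideleGroup K) := inferInstance
  -- the `𝕀_K¹`-average and the test function
  set eav : (AdelicGroupData.gl n K).Adelic → ℝ≥0∞ := fun y => ∫⁻ b, W (sc (b : ideleGroup K) * y) * β₁ b ∂β with heav
  have hWb_meas : Measurable fun q : (AdelicGroupData.gl n K).Adelic × ↥(normOneIdeles K) =>
      W (sc (q.2 : ideleGroup K) * q.1) * β₁ q.2 := by
    refine Measurable.mul (hW.comp ?_) (hβ₁.measurable.comp measurable_snd)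
    exact ((hsc_cont.comp (continuous_subtype_val.comp continuous_snd)).mul continuous_fst).measurable
  have heav_meas : Measurable eav := hWb_meas.lintegral_prod_right'
  have heavK : ∀ (γ : GL (Fin n) K) (y : (AdelicGroupData.gl n K).Adelic),
      eav ((AdelicGroupData.gl n K).toAdelic γ * y) = eav y := by
    intro γ y
    simp only [heav]
    refine lintegral_congr fun b => ?_
    rw [← mul_assoc, hsc_comm, mul_assoc, hWK]
  set f : (AdelicGroupData.gl n K).Adelic → ℝ≥0∞ := fun y => eav y⁻¹ * βA y⁻¹ with hf
  have hf_meas : Measurable f :=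
    (heav_meas.comp continuous_inv.measurable).mul (hβA.comp continuous_inv.measurable)
  change ∫⁻ h : ↥(AdelicGroupData.gl n K).quotientSubgroup, f (g * (h : (AdelicGroupData.gl n K).Adelic))
    ∂quotientSubgroupHaar n K = _
  -- (a) the product structure of `ρ_H`
  have hFh : Measurable fun h : ↥(AdelicGroupData.gl n K).quotientSubgroup =>
      f (g * (h : (AdelicGroupData.gl n K).Adelic)) :=
    hf_meas.comp (measurable_const.mul measurable_subtype_coe)
  rw [hfib _ hFh]
  -- (b) the sum over `GL_n(K)` collapses the covering weight
  have hsum : ∀ a : ↥(AdelicGroupData.gl n K).center',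
      ∑' γ : ↥(AdelicGroupData.gl n K).arithmeticSubgroup,
        f (g * (((quotientSubgroupEquiv n K).symm (a, γ) : ↥(AdelicGroupData.gl n K).quotientSubgroup) :
            (AdelicGroupData.gl n K).Adelic)) =
        eav ((a : (AdelicGroupData.gl n K).Adelic)⁻¹ * g⁻¹) := by
    intro a
    have e1 : ∀ γ : ↥(AdelicGroupData.gl n K).arithmeticSubgroup,
        f (g * (((quotientSubgroupEquiv n K).symm (a, γ) : ↥(AdelicGroupData.gl n K).quotientSubgroup) :
            (AdelicGroupData.gl n K).Adelic)) =
          eav ((a : (AdelicGroupData.gl n K).Adelic)⁻¹ * g⁻¹) *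
            βA ((γ : (AdelicGroupData.gl n K).Adelic)⁻¹ * ((a : (AdelicGroupData.gl n K).Adelic)⁻¹ * g⁻¹)) := by
      intro γ
      obtain ⟨γ₀, hγ₀⟩ := γ.2
      have hγinv : ((γ : (AdelicGroupData.gl n K).Adelic))⁻¹ = (AdelicGroupData.gl n K).toAdelic γ₀⁻¹ := by
        rw [map_inv, hγ₀]
      rw [coe_quotientSubgroupEquiv_symm_apply]
      simp only [hf, mul_inv_rev]
      rw [mul_assoc ((γ : (AdelicGroupData.gl n K).Adelic))⁻¹]
      congr 1
      rw [hγinv, heavK]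
    simp_rw [e1]
    rw [ENNReal.tsum_mul_left]
    -- `Σ_γ β((γ)⁻¹ y) = Σ_γ β(γ y) = 1`
    have e2 : ∑' γ : ↥(AdelicGroupData.gl n K).arithmeticSubgroup,
        βA ((γ : (AdelicGroupData.gl n K).Adelic)⁻¹ * ((a : (AdelicGroupData.gl n K).Adelic)⁻¹ * g⁻¹)) =
        coveringSum ↥(AdelicGroupData.gl n K).arithmeticSubgroup βA ((a : (AdelicGroupData.gl n K).Adelic)⁻¹ * g⁻¹) := by
      rw [coveringSum_apply, ← (Equiv.inv ↥(AdelicGroupData.gl n K).arithmeticSubgroup).tsum_eq]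
      rfl
    rw [e2, hβAsum, mul_one]
  simp_rw [hsum]
  -- (c) `∫_{A_G} dα_A = ∫_{ρ(ℝ>0)} dα`, inversion on `ρ(ℝ>0)`, and `sc(p)⁻¹ = sc(p⁻¹)`
  have hmeas_c : Measurable fun a : ↥(AdelicGroupData.gl n K).center' =>
      eav ((a : (AdelicGroupData.gl n K).Adelic)⁻¹ * g⁻¹) :=
    heav_meas.comp ((measurable_subtype_coe.inv).mul measurable_const)
  have hecm : Measurable (fun p : ↥(posRealIdeles K) => ec p) := ec.continuous.measurable
  have e3 : ∫⁻ a, eav ((a : (AdelicGroupData.gl n K).Adelic)⁻¹ * g⁻¹) ∂(Measure.map ec α) =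
      ∫⁻ p, eav (sc (p : ideleGroup K) * g⁻¹) ∂α := by
    rw [lintegral_map hmeas_c hecm,
      ← lintegral_inv_eq_self (μ := α) (fun p => eav (sc (p : ideleGroup K) * g⁻¹))]
    refine lintegral_congr fun p => ?_
    rw [hec p, Subgroup.coe_inv, map_inv]
  rw [e3]
  -- (d) unfold the average, recombine `ρ(ℝ>0) × 𝕀_K¹` into `𝕀_K`, then fold `𝕀_K` onto `𝓕` by `Kˣ`
  set Gx : ideleGroup K → ℝ≥0∞ := fun x => W (sc x * g⁻¹) *
    β₁ ⟨normOneRetraction K x, normOneRetraction_mem K x⟩ with hGx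
  have hGx_meas : Measurable Gx := by
    refine Measurable.mul (hW.comp (hsc_cont.mul continuous_const).measurable) (hβ₁.measurable.comp ?_)
    exact ((continuous_normOneRetraction K).subtype_mk _).measurable
  have e4 : ∫⁻ p, eav (sc (p : ideleGroup K) * g⁻¹) ∂α =
      ∫⁻ p, ∫⁻ b, Gx ((b : ideleGroup K) * (p : ideleGroup K)) ∂β ∂α := by
    refine lintegral_congr fun p => lintegral_congr fun b => ?_
    have hr : normOneRetraction K ((b : ideleGroup K) * (p : ideleGroup K)) = b := by
      rw [map_mul, normOneRetraction_eq_self K (mem_normOneIdeles.1 b.2), normOneRetraction_eq_one_of_mem K p.2,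
        mul_one]
    have hb : (⟨normOneRetraction K ((b : ideleGroup K) * (p : ideleGroup K)), normOneRetraction_mem K _⟩ :
        ↥(normOneIdeles K)) = b := Subtype.ext hr
    simp only [hGx]
    rw [hb, map_mul, mul_assoc]
  have e5 : ∫⁻ p, ∫⁻ b, Gx ((b : ideleGroup K) * (p : ideleGroup K)) ∂β ∂α = (κ₁ : ℝ≥0∞)⁻¹ * ∫⁻ x, Gx x ∂νI := by
    rw [hsplit Gx hGx_meas, ← mul_assoc, ENNReal.inv_mul_cancel hκ₁ ENNReal.coe_ne_top, one_mul]
  -- the `Kˣ`-unfolding of `∫ Gx dν_I`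
  set b₀ : ideleGroup K → ↥(normOneIdeles K) := fun x => ⟨normOneRetraction K x, normOneRetraction_mem K x⟩ with hb₀
  set ι₁ : ↥(principalIdeles K) → ↥((principalIdeles K).subgroupOf (normOneIdeles K)) := fun k =>
    ⟨⟨(k : ideleGroup K), principalIdeles_le_normOneIdeles K k.2⟩, Subgroup.mem_subgroupOf.2 k.2⟩ with hι₁
  have e7 : ∀ (x : ideleGroup K) (k : ↥(principalIdeles K)), Gx (k • x) = W (sc x * g⁻¹) * β₁ (ι₁ k • b₀ x) := by
    intro x k
    obtain ⟨γ, hγ⟩ := hscK k k.2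
    have h1 : W (sc ((k : ideleGroup K) * x) * g⁻¹) = W (sc x * g⁻¹) := by
      rw [map_mul, mul_assoc, ← hγ, hWK]
    have h2 : b₀ ((k : ideleGroup K) * x) = ι₁ k • b₀ x := by
      refine Subtype.ext ?_
      change normOneRetraction K ((k : ideleGroup K) * x) = (k : ideleGroup K) * normOneRetraction K x
      rw [map_mul, normOneRetraction_eq_self K (ideleNorm_principal k.2)]
    change W (sc ((k : ideleGroup K) * x) * g⁻¹) * β₁ (b₀ ((k : ideleGroup K) * x)) = _
    rw [h1, h2]
  have e8 : ∀ x : ideleGroup K, ∑' k : ↥(principalIdeles K), β₁ (ι₁ k • b₀ x) =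
      coveringSum ↥((principalIdeles K).subgroupOf (normOneIdeles K)) β₁ (b₀ x) := by
    intro x
    rw [coveringSum_apply]
    exact ((Subgroup.subgroupOfEquivOfLe (principalIdeles_le_normOneIdeles K)).symm.toEquiv).tsum_eq
      (fun k' : ↥((principalIdeles K).subgroupOf (normOneIdeles K)) => β₁ (k' • b₀ x))
  have e6 : ∫⁻ x, Gx x ∂νI = ∫⁻ x in 𝓕, W (sc x * g⁻¹) ∂νI := by
    rw [lintegral_eq_setLIntegral_tsum_smul νI (h𝓕.isFundamentalDomain νI) hGx_meas.aemeasurable]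
    refine setLIntegral_congr_fun h𝓕.measurableSet fun x _ => ?_
    simp_rw [e7 x]
    rw [ENNReal.tsum_mul_left, e8 x, hβ₁.coveringSum_eq, mul_one]
  rw [e4, e5, e6]
  ring

/-- **The group side: the `𝕀_K¹`-average disappears** (Step 3 of
`exists_lintegral_eisensteinLIntegral_mul_eq`). For a Haar measure `ν` on the unimodular `GL_n(𝔸_K)`, a
central continuous `sc : 𝔸_Kˣ → GL_n(𝔸_K)`, `W ≥ 0` invariant under `GL_n(K)`, `F ≥ 0` on the quotient
invariant under `sc(𝔸_Kˣ)`, a `GL_n(K)`-covering weight `β` and a measurable `β¹ ≥ 0` on `𝕀_K¹`: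

  `∫ f(g) F(π g) dν = (∫ β¹ dβ) ∫ W(g) β(g) F(π g⁻¹) dν(g)`,  `f(y) = (∫_{𝕀¹} W(sc(b) y⁻¹) β¹(b) dβ) β(y⁻¹)`

(inversion `g ↦ g⁻¹`, Tonelli, the translation `g ↦ sc(b)⁻¹ g`, the central invariance of `F`, and the
independence of the covering weight, `lintegral_mul_eq_of_coveringSum_eq`). [folklore] -/
theorem lintegral_testFun_mul_eq
    (ν : Measure (AdelicGroupData.gl n K).Adelic) [ν.IsHaarMeasure] [ν.IsInvInvariant]
    (β : Measure ↥(normOneIdeles K)) [SFinite β]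
    (sc : ideleGroup K →* (AdelicGroupData.gl n K).Adelic) (hsc_cont : Continuous sc)
    (hsc_comm : ∀ (a : ideleGroup K) (g : (AdelicGroupData.gl n K).Adelic), sc a * g = g * sc a)
    {β₁ : ↥(normOneIdeles K) → ℝ≥0∞} (hβ₁ : Measurable β₁)
    {W : (AdelicGroupData.gl n K).Adelic → ℝ≥0∞} (hW : Measurable W)
    (hWK : ∀ (γ : GL (Fin n) K) (y : (AdelicGroupData.gl n K).Adelic), W ((AdelicGroupData.gl n K).toAdelic γ * y) = W y)
    {βA : (AdelicGroupData.gl n K).Adelic → ℝ≥0∞} (hβA : Measurable βA)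
    (hβAsum : ∀ y, coveringSum ↥(AdelicGroupData.gl n K).arithmeticSubgroup βA y = 1)
    {F : (AdelicGroupData.gl n K).automorphicQuotient → ℝ≥0∞} (hF : Measurable F)
    (hFZ : ∀ (z : ideleGroup K) (y : (AdelicGroupData.gl n K).Adelic),
      F ((AdelicGroupData.gl n K).toAutomorphicQuotient (sc z * y)) = F ((AdelicGroupData.gl n K).toAutomorphicQuotient y)) :
    ∫⁻ g, (∫⁻ b, W (sc (b : ideleGroup K) * g⁻¹) * β₁ b ∂β) * βA g⁻¹ *
        F ((AdelicGroupData.gl n K).toAutomorphicQuotient g) ∂ν =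
      (∫⁻ b, β₁ b ∂β) * ∫⁻ g, W g * βA g * F ((AdelicGroupData.gl n K).toAutomorphicQuotient g⁻¹) ∂ν := by
  classical
  haveI := secondCountableTopology_ideleGroup K
  have hπ : ∀ g : (AdelicGroupData.gl n K).Adelic, (AdelicGroupData.gl n K).toAutomorphicQuotient g =
      (QuotientGroup.mk g : (AdelicGroupData.gl n K).automorphicQuotient) := fun g => rfl
  have hWb_meas : Measurable fun q : (AdelicGroupData.gl n K).Adelic × ↥(normOneIdeles K) =>
      W (sc (q.2 : ideleGroup K) * q.1) * β₁ q.2 := by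
    refine Measurable.mul (hW.comp ?_) (hβ₁.comp measurable_snd)
    exact ((hsc_cont.comp (continuous_subtype_val.comp continuous_snd)).mul continuous_fst).measurable
  have heav_b : ∀ y : (AdelicGroupData.gl n K).Adelic,
      Measurable fun b : ↥(normOneIdeles K) => W (sc (b : ideleGroup K) * y) * β₁ b := fun y =>
    hWb_meas.comp (f := fun b : ↥(normOneIdeles K) => (y, b)) (measurable_const.prodMk measurable_id)
  have hFq : Measurable fun g : (AdelicGroupData.gl n K).Adelic => F ((AdelicGroupData.gl n K).toAutomorphicQuotient g⁻¹) :=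
    hF.comp ((AdelicGroupData.gl n K).continuous_toAutomorphicQuotient.measurable.comp continuous_inv.measurable)
  -- inversion `g ↦ g⁻¹`
  have e1 : ∫⁻ g, (∫⁻ b, W (sc (b : ideleGroup K) * g⁻¹) * β₁ b ∂β) * βA g⁻¹ *
        F ((AdelicGroupData.gl n K).toAutomorphicQuotient g) ∂ν =
      ∫⁻ g, (∫⁻ b, W (sc (b : ideleGroup K) * g) * β₁ b ∂β) * βA g *
        F ((AdelicGroupData.gl n K).toAutomorphicQuotient g⁻¹) ∂ν := by
    rw [← lintegral_inv_eq_self (μ := ν)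
      (fun g : (AdelicGroupData.gl n K).Adelic => (∫⁻ b, W (sc (b : ideleGroup K) * g⁻¹) * β₁ b ∂β) * βA g⁻¹ *
        F ((AdelicGroupData.gl n K).toAutomorphicQuotient g))]
    refine lintegral_congr fun g => ?_
    simp only [inv_inv]
  rw [e1]
  -- Tonelli
  have e2 : ∫⁻ g, (∫⁻ b, W (sc (b : ideleGroup K) * g) * β₁ b ∂β) * βA g *
        F ((AdelicGroupData.gl n K).toAutomorphicQuotient g⁻¹) ∂ν =
      ∫⁻ b, ∫⁻ g, W (sc (b : ideleGroup K) * g) * β₁ b *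
        (βA g * F ((AdelicGroupData.gl n K).toAutomorphicQuotient g⁻¹)) ∂ν ∂β := by
    have e3 : ∀ g : (AdelicGroupData.gl n K).Adelic,
        (∫⁻ b, W (sc (b : ideleGroup K) * g) * β₁ b ∂β) * βA g * F ((AdelicGroupData.gl n K).toAutomorphicQuotient g⁻¹) =
        ∫⁻ b, W (sc (b : ideleGroup K) * g) * β₁ b * (βA g * F ((AdelicGroupData.gl n K).toAutomorphicQuotient g⁻¹)) ∂β := by
      intro g
      rw [mul_assoc, lintegral_mul_const _ (heav_b g)]
    simp_rw [e3]
    exact lintegral_lintegral_swap (hWb_meas.mul ((hβA.mul hFq).comp measurable_fst)).aemeasurable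
  rw [e2]
  -- for each `b`: translate by `sc(b)⁻¹`, use the central invariance of `F` and change the covering weight
  have e4 : ∀ b : ↥(normOneIdeles K),
      ∫⁻ g, W (sc (b : ideleGroup K) * g) * β₁ b * (βA g * F ((AdelicGroupData.gl n K).toAutomorphicQuotient g⁻¹)) ∂ν =
        β₁ b * ∫⁻ g, W g * βA g * F ((AdelicGroupData.gl n K).toAutomorphicQuotient g⁻¹) ∂ν := by
    intro b
    set z : (AdelicGroupData.gl n K).Adelic := sc (b : ideleGroup K) with hz
    -- translate `g ↦ z⁻¹ g`
    have e5 : ∫⁻ g, W (z * g) * β₁ b * (βA g * F ((AdelicGroupData.gl n K).toAutomorphicQuotient g⁻¹)) ∂ν =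
        ∫⁻ g, W g * β₁ b * (βA (z⁻¹ * g) * F ((AdelicGroupData.gl n K).toAutomorphicQuotient g⁻¹)) ∂ν := by
      have h := lintegral_mul_left_eq_self (μ := ν)
        (fun g : (AdelicGroupData.gl n K).Adelic => W g * β₁ b *
          (βA (z⁻¹ * g) * F ((AdelicGroupData.gl n K).toAutomorphicQuotient g⁻¹))) z
      rw [← h]
      refine lintegral_congr fun g => ?_
      simp only [inv_mul_cancel_left, mul_inv_rev]
      congr 2
      -- `F(π g⁻¹) = F(π (g⁻¹ z⁻¹))`: `g⁻¹ z⁻¹ = z⁻¹ g⁻¹` and `F` is invariant under the centre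
      have hcomm : g⁻¹ * z⁻¹ = z⁻¹ * g⁻¹ := by
        rw [hz, ← map_inv]
        exact (hsc_comm _ _).symm
      rw [hcomm, hz, ← map_inv]
      exact (hFZ (b : ideleGroup K)⁻¹ _).symm
    rw [e5]
    -- pull out the constant `β¹ b` and change the covering weight `β(z⁻¹ ·)` back to `β`
    have e6 : ∀ g : (AdelicGroupData.gl n K).Adelic, W g * β₁ b *
        (βA (z⁻¹ * g) * F ((AdelicGroupData.gl n K).toAutomorphicQuotient g⁻¹)) =
        β₁ b * (W g * F ((AdelicGroupData.gl n K).toAutomorphicQuotient g⁻¹) * βA (z⁻¹ * g)) := fun g => by ring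
    simp_rw [e6]
    have hΦm : Measurable fun g : (AdelicGroupData.gl n K).Adelic =>
        W g * F ((AdelicGroupData.gl n K).toAutomorphicQuotient g⁻¹) := hW.mul hFq
    have hβz : Measurable fun g : (AdelicGroupData.gl n K).Adelic => βA (z⁻¹ * g) :=
      hβA.comp (measurable_const.mul measurable_id)
    rw [lintegral_const_mul (β₁ b)
      (f := fun g => W g * F ((AdelicGroupData.gl n K).toAutomorphicQuotient g⁻¹) * βA (z⁻¹ * g)) (hΦm.mul hβz)]
    congr 1
    have hΦinv : ∀ (γ : ↥(AdelicGroupData.gl n K).arithmeticSubgroup) (g : (AdelicGroupData.gl n K).Adelic),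
        W (γ • g) * F ((AdelicGroupData.gl n K).toAutomorphicQuotient (γ • g)⁻¹) =
          W g * F ((AdelicGroupData.gl n K).toAutomorphicQuotient g⁻¹) := by
      intro γ g
      obtain ⟨γ₀, hγ₀⟩ := γ.2
      rw [Subgroup.smul_def, smul_eq_mul, ← hγ₀, hWK, mul_inv_rev]
      congr 2
      -- `π(g⁻¹ γ₀⁻¹) = π(g⁻¹)`
      rw [hπ, hπ]
      refine QuotientGroup.eq.2 ?_
      rw [mul_inv_rev, inv_inv, inv_inv, mul_assoc, mul_inv_cancel, mul_one]
      exact (AdelicGroupData.gl n K).arithmeticSubgroup_le_quotientSubgroup ⟨γ₀, rfl⟩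
    have hβGz : ∀ g : (AdelicGroupData.gl n K).Adelic,
        coveringSum ↥(AdelicGroupData.gl n K).arithmeticSubgroup
          (fun g : (AdelicGroupData.gl n K).Adelic => βA (z⁻¹ * g)) g = 1 := by
      intro g
      simp only [coveringSum_apply]
      have : ∀ γ : ↥(AdelicGroupData.gl n K).arithmeticSubgroup, βA (z⁻¹ * (γ • g)) = βA (γ • (z⁻¹ * g)) := by
        intro γ
        rw [Subgroup.smul_def, Subgroup.smul_def, smul_eq_mul, smul_eq_mul, ← mul_assoc, ← mul_assoc]
        congr 2
        rw [hz, ← map_inv]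
        exact hsc_comm _ _
      simp_rw [this]
      have h := hβAsum (z⁻¹ * g)
      rw [coveringSum_apply] at h
      exact h
    have h := lintegral_mul_eq_of_coveringSum_eq ν hΦm hΦinv hβz hβA one_ne_zero ENNReal.one_ne_top hβGz hβAsum
    rw [h]
    refine lintegral_congr fun g => ?_
    ring
  simp_rw [e4]
  rw [lintegral_mul_const _ hβ₁]

/-- **The first unfolding of the Rankin–Selberg integral, for a general weight, in `[0, ∞]`.** Let
`0 < n`, `μ` an automorphic measure on `X = GL_n(𝔸_K) ⧸ A_G GL_n(K)`, `ν` a Haar measure on `GL_n(𝔸_K)`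
and `ν_I` a Haar measure on `𝔸_Kˣ`. There is `C ∈ (0, ∞)`, depending only on these measures, such that
for every idele class domain `𝓕`, every measurable `W ≥ 0` on `GL_n(𝔸_K)` left invariant under `GL_n(K)`,
every measurable `F ≥ 0` on `X` invariant under the centre `Z(𝔸_K) = 𝔸_Kˣ 1_n`, every measurable `E_X` on
`X` with `E_X(π g) = ∫_𝓕 W((a 1_n) g⁻¹) dν_I(a)` (the idele-class Eisenstein integral `E_W(g⁻¹)`, a
function on `X` by `setLIntegral_ideleClassDomain_scalar_mul_eq_of_mem`) and every measurable
`GL_n(K)`-covering weight `β`,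

  `∫_X E_X(x) F(x) dμ(x) = C ∫_{GL_n(𝔸_K)} W(g) β(g) F(π g⁻¹) dν(g)`.

This is the unfolding `∫_{Z GL_n(k)\GL_n(𝔸)} |φ|² E(g,Φ;s) dg = ∫_{GL_n(k)\GL_n(𝔸)} |φ|² E_w(g) dg`,
`E(g) = ∫_{kˣ\𝔸ˣ} E_w(a g) d^×a`, of Jacquet–Shalika (1981), §4 / Cogdell (2004), §2.3, on the tree's
quotient by `A_G GL_n(K)` (whose fibres over `Z(𝔸) GL_n(k) \ GL_n(𝔸)` are the compact `𝕀_K¹/Kˣ`,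
contributing the volume factor inside `C`). The group-side data `W`, `β`, `g` are in the spelling
`GL (Fin n) (AdeleRing (𝓞 K) K)` of the Whittaker tower, the measure `ν` and the quotient in the spelling
`(AdelicGroupData.gl n K).Adelic` of `GLnAutomorphicUnfolding` (the two types and their Borel structures
are definitionally equal). [cite: JacquetShalikaAJM1981, §4] -/
theorem exists_lintegral_eisensteinLIntegral_mul_eq (hn : 0 < n)
    (μ : Measure (AdelicGroupData.gl n K).automorphicQuotient) [(AdelicGroupData.gl n K).IsAutomorphicMeasure μ]
    (ν : Measure (AdelicGroupData.gl n K).Adelic) [ν.IsHaarMeasure]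
    (νI : Measure (ideleGroup K)) [νI.IsHaarMeasure] :
    ∃ C : ℝ≥0∞, C ≠ 0 ∧ C ≠ ⊤ ∧
      ∀ {𝓕 : Set (ideleGroup K)}, IsIdeleClassDomain K 𝓕 →
      ∀ {W : GL (Fin n) (AdeleRing (𝓞 K) K) → ℝ≥0∞}, Measurable W →
        (∀ (γ : GL (Fin n) K) (g : GL (Fin n) (AdeleRing (𝓞 K) K)),
          W (Matrix.GeneralLinearGroup.map (algebraMap K (AdeleRing (𝓞 K) K)) γ * g) = W g) →
      ∀ {F : (AdelicGroupData.gl n K).automorphicQuotient → ℝ≥0∞}, Measurable F →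
        (∀ (z : ideleGroup K) (g : GL (Fin n) (AdeleRing (𝓞 K) K)),
          F ((AdelicGroupData.gl n K).toAutomorphicQuotient (Matrix.GeneralLinearGroup.scalar (Fin n) z * g)) =
            F ((AdelicGroupData.gl n K).toAutomorphicQuotient g)) →
      ∀ {EX : (AdelicGroupData.gl n K).automorphicQuotient → ℝ≥0∞}, Measurable EX →
        (∀ g : GL (Fin n) (AdeleRing (𝓞 K) K), EX ((AdelicGroupData.gl n K).toAutomorphicQuotient g) =
          ∫⁻ a in 𝓕, W (Matrix.GeneralLinearGroup.scalar (Fin n) a * g⁻¹) ∂νI) →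
      ∀ {βG : GL (Fin n) (AdeleRing (𝓞 K) K) → ℝ≥0∞}, Measurable βG →
        (∀ g, coveringSum ↥(ratPoints (⊤ : Subgroup (GL (Fin n) K))) βG g = 1) →
        ∫⁻ x, EX x * F x ∂μ =
          C * ∫⁻ g, W g * βG g * F ((AdelicGroupData.gl n K).toAutomorphicQuotient g⁻¹) ∂ν := by
  classical
  haveI := secondCountableTopology_ideleGroup K
  haveI := t2Space_ideleGroup K
  haveI := locallyCompactSpace_ideleGroup K
  haveI := locallyCompactSpace_normOneIdeles K
  haveI := locallyCompactSpace_posRealIdeles K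
  haveI : BorelSpace ↥(normOneIdeles K) := Subtype.borelSpace _
  haveI : BorelSpace ↥(posRealIdeles K) := Subtype.borelSpace _
  haveI : SecondCountableTopology ↥(normOneIdeles K) := TopologicalSpace.Subtype.secondCountableTopology _
  haveI : SecondCountableTopology ↥(posRealIdeles K) := TopologicalSpace.Subtype.secondCountableTopology _
  haveI : BorelSpace ↥(AdelicGroupData.gl n K).center' := Subtype.borelSpace _
  haveI : BorelSpace ↥(AdelicGroupData.gl n K).arithmeticSubgroup := Subtype.borelSpace _
  haveI : BorelSpace ↥(AdelicGroupData.gl n K).quotientSubgroup := Subtype.borelSpace _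
  -- unimodularity of `GL_n(𝔸_K)`
  haveI : ν.IsMulRightInvariant := GLn.isMulRightInvariant_of_isHaarMeasure_adelic_holds n K ν inferInstance
  haveI : ν.IsInvInvariant := isInvInvariant_of_isMulRightInvariant ν
  -- auxiliary Haar measures on `𝕀_K¹`, `ρ(ℝ_{>0})` and `A_G`
  set β : Measure ↥(normOneIdeles K) := Measure.haar with hβ
  set α : Measure ↥(posRealIdeles K) := Measure.haar with hα
  haveI : α.IsInvInvariant := inferInstance
  obtain ⟨ec, hec⟩ := exists_continuousMulEquiv_posRealIdeles_center' n K hn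
  set αA : Measure ↥(AdelicGroupData.gl n K).center' := Measure.map ec α with hαA
  haveI : αA.IsHaarMeasure := ec.toMulEquiv.isHaarMeasure_map α ec.continuous ec.symm.continuous
  -- the three constants: idele splitting, fibre product structure, unfolding
  obtain ⟨κ₁, hκ₁, hsplit⟩ := exists_lintegral_ideleGroup_eq_mul_lintegral_lintegral K νI β α
  obtain ⟨κ, hκ, hfib⟩ := exists_lintegral_quotientSubgroup_eq_mul_lintegral_tsum (quotientSubgroupHaar n K) αA
  obtain ⟨β₁, hβ₁, hV0, hVtop⟩ := exists_isCoveringWeight_normOne K β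
  set V : ℝ≥0∞ := ∫⁻ b, β₁ b ∂β with hV
  set c : ℝ≥0∞ := (automorphicUnfoldingConstant n K μ ν : ℝ≥0∞) with hc
  have hc0 : c ≠ 0 := by rw [hc]; exact_mod_cast (automorphicUnfoldingConstant_pos n K μ ν).ne'
  have hκ0 : (κ : ℝ≥0∞) ≠ 0 := by exact_mod_cast hκ.ne'
  have hκ₁0 : (κ₁ : ℝ≥0∞) ≠ 0 := by exact_mod_cast hκ₁.ne'
  refine ⟨(κ : ℝ≥0∞)⁻¹ * κ₁ * c * V, ?_, ?_, ?_⟩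
  · exact mul_ne_zero (mul_ne_zero (mul_ne_zero (ENNReal.inv_ne_zero.2 ENNReal.coe_ne_top) hκ₁0) hc0) hV0
  · exact ENNReal.mul_ne_top (ENNReal.mul_ne_top (ENNReal.mul_ne_top (ENNReal.inv_ne_top.2 hκ0) ENNReal.coe_ne_top)
      ENNReal.coe_ne_top) hVtop
  intro 𝓕 h𝓕 W hW hWK F hF hFZ EX hEX hEXg βG hβG hβGsum
  ----------------------------------------------------------------
  -- the data in the spelling `(AdelicGroupData.gl n K).Adelic`
  ----------------------------------------------------------------
  set sc : ideleGroup K →* (AdelicGroupData.gl n K).Adelic := Matrix.GeneralLinearGroup.scalar (Fin n) with hsc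
  have hsc_cont : Continuous sc := continuous_generalLinearGroup_scalar_adele n K
  have hsc_comm : ∀ (a : ideleGroup K) (g : (AdelicGroupData.gl n K).Adelic), sc a * g = g * sc a := fun a g =>
    Matrix.GeneralLinearGroup.scalar_commute a g
  have hscK : ∀ k : ideleGroup K, k ∈ principalIdeles K →
      ∃ γ : GL (Fin n) K, (AdelicGroupData.gl n K).toAdelic γ = sc k := by
    intro k hk
    obtain ⟨γ, hγ⟩ := exists_map_eq_scalar_of_mem_principalIdeles (n := n) hk
    exact ⟨γ, hγ⟩
  set Wg : (AdelicGroupData.gl n K).Adelic → ℝ≥0∞ := fun y => W y with hWg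
  set βA : (AdelicGroupData.gl n K).Adelic → ℝ≥0∞ := fun y => βG y with hβAdef
  have hWg_meas : Measurable Wg := hW
  have hβA_meas : Measurable βA := hβG
  have hWgK : ∀ (γ : GL (Fin n) K) (y : (AdelicGroupData.gl n K).Adelic),
      Wg ((AdelicGroupData.gl n K).toAdelic γ * y) = Wg y := fun γ y => hWK γ y
  have hFZ' : ∀ (z : ideleGroup K) (y : (AdelicGroupData.gl n K).Adelic),
      F ((AdelicGroupData.gl n K).toAutomorphicQuotient (sc z * y)) = F ((AdelicGroupData.gl n K).toAutomorphicQuotient y) :=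
    fun z y => hFZ z y
  have hEXg' : ∀ y : (AdelicGroupData.gl n K).Adelic, EX ((AdelicGroupData.gl n K).toAutomorphicQuotient y) =
      ∫⁻ a in 𝓕, Wg (sc a * y⁻¹) ∂νI := fun y => hEXg y
  have hβAsum : ∀ y : (AdelicGroupData.gl n K).Adelic,
      coveringSum ↥(AdelicGroupData.gl n K).arithmeticSubgroup βA y = 1 := by
    intro y
    have h := hβGsum y
    rw [ratPoints_top_eq_arithmeticSubgroup] at h
    exact h
  -- the test function
  set f : (AdelicGroupData.gl n K).Adelic → ℝ≥0∞ := fun y =>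
    (∫⁻ b, Wg (sc (b : ideleGroup K) * y⁻¹) * β₁ b ∂β) * βA y⁻¹ with hf
  have hWb_meas : Measurable fun q : (AdelicGroupData.gl n K).Adelic × ↥(normOneIdeles K) =>
      Wg (sc (q.2 : ideleGroup K) * q.1) * β₁ q.2 := by
    refine Measurable.mul (hWg_meas.comp ?_) (hβ₁.measurable.comp measurable_snd)
    exact ((hsc_cont.comp (continuous_subtype_val.comp continuous_snd)).mul continuous_fst).measurable
  have hf_meas : Measurable f :=
    (hWb_meas.lintegral_prod_right'.comp continuous_inv.measurable).mul (hβA_meas.comp continuous_inv.measurable)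
  ----------------------------------------------------------------
  -- Step 1 and Step 2: the fibre integral of `f` and Weil's formula
  ----------------------------------------------------------------
  have hunf := lintegral_fiberLIntegral_mul_eq_automorphic n K μ ν hf_meas hF
  have hL : ∫⁻ x, fiberLIntegral (AdelicGroupData.gl n K).quotientSubgroup (quotientSubgroupHaar n K) f x * F x ∂μ =
      (κ : ℝ≥0∞) * (κ₁ : ℝ≥0∞)⁻¹ * ∫⁻ x, EX x * F x ∂μ := by
    rw [← lintegral_const_mul ((κ : ℝ≥0∞) * (κ₁ : ℝ≥0∞)⁻¹) (f := fun x => EX x * F x) (hEX.mul hF)]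
    refine lintegral_congr fun x => ?_
    obtain ⟨g, rfl⟩ := QuotientGroup.mk_surjective x
    have h1 := lintegral_quotientSubgroup_testFun_eq νI β α sc hsc_cont hsc_comm hscK ec hec (κ := κ) hκ₁0 hsplit hfib
      hβ₁ h𝓕 hWg_meas hWgK hβA_meas hβAsum g
    have h2 : fiberLIntegral (AdelicGroupData.gl n K).quotientSubgroup (quotientSubgroupHaar n K) f
        (QuotientGroup.mk g : (AdelicGroupData.gl n K).automorphicQuotient) =
        (κ : ℝ≥0∞) * (κ₁ : ℝ≥0∞)⁻¹ * EX ((AdelicGroupData.gl n K).toAutomorphicQuotient g) := by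
      rw [fiberLIntegral_mk, hEXg' g]
      exact h1
    change fiberLIntegral (AdelicGroupData.gl n K).quotientSubgroup (quotientSubgroupHaar n K) f
        (QuotientGroup.mk g : (AdelicGroupData.gl n K).automorphicQuotient) * F _ = _
    rw [h2, mul_assoc]
    rfl
  ----------------------------------------------------------------
  -- Step 3: the group side
  ----------------------------------------------------------------
  have hR : ∫⁻ g, f g * F ((AdelicGroupData.gl n K).toAutomorphicQuotient g) ∂ν =
      V * ∫⁻ g, W g * βG g * F ((AdelicGroupData.gl n K).toAutomorphicQuotient g⁻¹) ∂ν :=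
    lintegral_testFun_mul_eq ν β sc hsc_cont hsc_comm hβ₁.measurable hWg_meas hWgK hβA_meas hβAsum hF hFZ'
  ----------------------------------------------------------------
  -- Step 4: assemble
  ----------------------------------------------------------------
  rw [hL, hR] at hunf
  -- `κ κ₁⁻¹ ∫ EX F = c V ∫ …` ⟹ `∫ EX F = κ⁻¹ κ₁ c V ∫ …`
  have hk : (κ : ℝ≥0∞) * (κ₁ : ℝ≥0∞)⁻¹ ≠ 0 := mul_ne_zero hκ0 (ENNReal.inv_ne_zero.2 ENNReal.coe_ne_top)
  have hk' : (κ : ℝ≥0∞) * (κ₁ : ℝ≥0∞)⁻¹ ≠ ⊤ := ENNReal.mul_ne_top ENNReal.coe_ne_top (ENNReal.inv_ne_top.2 hκ₁0)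
  calc ∫⁻ x, EX x * F x ∂μ
      = ((κ : ℝ≥0∞) * (κ₁ : ℝ≥0∞)⁻¹)⁻¹ * ((κ : ℝ≥0∞) * (κ₁ : ℝ≥0∞)⁻¹ * ∫⁻ x, EX x * F x ∂μ) := by
        rw [← mul_assoc, ENNReal.inv_mul_cancel hk hk', one_mul]
    _ = ((κ : ℝ≥0∞) * (κ₁ : ℝ≥0∞)⁻¹)⁻¹ * (c * (V * ∫⁻ g,
          W g * βG g * F ((AdelicGroupData.gl n K).toAutomorphicQuotient g⁻¹) ∂ν)) := by
        rw [hunf]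
    _ = (κ : ℝ≥0∞)⁻¹ * κ₁ * c * V * ∫⁻ g,
          W g * βG g * F ((AdelicGroupData.gl n K).toAutomorphicQuotient g⁻¹) ∂ν := by
        rw [ENNReal.mul_inv (Or.inl hκ0) (Or.inl ENNReal.coe_ne_top), inv_inv]
        ring

end Unfolding

end Literature.NumberTheory.Automorphic
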